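import Literature.NumberTheory.ModularForms.SturmCongruenceBound
import Literature.NumberTheory.EllipticCurves.DeligneSerreProp27LevelDescentProofs
import Literature.NumberTheory.EllipticCurves.NewformsMainLemmaProofs
import Literature.NumberTheory.EllipticCurves.CuspFormsGamma1EisensteinDivision
import Literature.NumberTheory.Automorphic.UnboundedDenominatorsReductions
import Literature.NumberTheory.ModularForms.QExpansionAlgebra
import Literature.NumberTheory.EllipticCurves.ModularCurveSturmProofs
import Literature.LinearAlgebra.BaseChange.LinearIndependentFieldExtension
import HarnessLib
-- buildfix (bf1-g32) B32-14: comment-only touch to re-dispatch the lane build (prune victim: hub olean removed 22:46Z 08-28; leaf of the SturmCongruence chain (lit-hodgefound p25 05:09Z report); parents SturmCongruence/SturmCongruenceBound rebuilt 08:09 after B32-12); declarations byte-identical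

/-!
# Sturm's congruence theorem for `Γ₁(N)` — proof of `Sturm1987_congruenceBound_Gamma1_modPrime`

Topic `Literature/NumberTheory/ModularForms`; a proofs-only companion of
`Literature/NumberTheory/ModularForms/SturmCongruenceBound.lean` (theorems only: no definition, no
named fact; D-0026). It discharges the named fact

* `Literature.NumberTheory.ModularForms.Sturm1987_congruenceBound_Gamma1_modPrime`
  (`Sturm1987_congruenceBound_Gamma1_modPrime_holds`): for `f ∈ S_k(Γ₁(N))` with rational-integer
  `q`-expansion coefficients `zₙ` and a prime `p`, if `p ∣ zₙ` for all `n ≤ ⌊k[SL₂(ℤ):Γ₁(N)]/12⌋`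
  then `p ∣ zₙ` for all `n` (the hypothesis `p ∤ N` recorded in the fact is not used).

**Source.** J. Sturm, *On the congruence of modular forms*, Number theory (New York 1984–85),
Lecture Notes in Math. 1240, Springer (1987), 275–280, Thm. 1 and its proof (p. 276). The proof is
written out in full in M. Ram Murty, *Congruences between modular forms*, in: Analytic number theory
(Kyoto 1996), London Math. Soc. Lecture Note Ser. 247, CUP (1997), 309–320, Thm. 5 ("Theorem
(Sturm)"), §3 (Prop. 6, the level-one case) and §4 (the norm argument), which we follow:

1. *Level one* (`levelOne_qExpansion_coeff_mem`; Murty Prop. 6): for an arbitrary additive subgroup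
   `P ⊆ ℂ` and `G ∈ M_k(SL₂(ℤ))`, if `bₙ(G) ∈ P` for `n ≤ ⌊k/12⌋` then all `bₙ(G) ∈ P` — induction
   on `k` through `G = b₀ E₄ᵃE₆ᵇ + Δ H` (Mathlib's `CuspForm.discriminantEquiv`) and the integrality
   of the `q`-expansions of `E₄`, `E₆` (tree: `exists_int_map_eq_qExpansion_E₄/E₆`) and `Δ` (tree:
   `exists_discriminant_qExpansion_eq_map`).
2. *A prime above `p`*: instead of a prime `𝔓 ∣ 𝔭` of the Hilbert class field of `F(ζ_N)` (Murty
   §4) we use a valuation subring `V ⊆ ℂ` whose maximal ideal `𝔪` contains `p` (Chevalley's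
   extension theorem, Mathlib `Ideal.image_subset_nonunits_valuationSubring`); `ord_𝔪` of power
   series over `V` is additive on products (`ordP_mul`, `ordP_prod`; Murty §2).
3. *Integrality and primitivity of the translates*
   (`exists_smul_cuspCoeff_mem_and_not_mem_nonunits`): every nonzero `ψ ∈ S_k(Γ₁(M))`, `k ≥ 1`,
   has a scalar multiple with all Fourier coefficients in `V` and one outside `𝔪`. This replaces
   "`f|γ ∈ M_k(Γ(N), F(ζ_N))` has bounded denominators (Shimura 1971, Thm. 3.52 and Thms. 6.6,
   6.9)" of Sturm–Murty by the tree's theorem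
   `DeligneSerre1974_span_integralLattice1_holds` (Deligne–Serre 1974, Prop. 2.7 (2.7.2): the
   integral cusp forms span `S_k(Γ₁(M))` over `ℂ`, all `M ≥ 1`), a `ℤ`-basis of the
   (`p`-saturated) lattice of integral forms staying linearly independent modulo `p`, and the
   residue field `V/𝔪 ⊇ 𝔽_p`.
4. *The translates at level `Γ₁(N²)`* (`coe_cuspHeckeCorrespondence_slToGLPos_mul_diagGL`,
   `cuspCoeff_cuspHeckeCorrespondence_slToGLPos_mul_diagGL`): for `γ ∈ SL₂(ℤ)` the double coset
   `Γ₁(N) (γ α_N) Γ₁(N²)`, `α_N = diag(N, 1)`, is a single coset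
   (`α_N Γ₁(N²) α_N⁻¹ ⊆ Γ(N) ⊴ SL₂(ℤ)`), so `(f|γ)|α_N ∈ S_k(Γ₁(N²))` with Fourier coefficients
   `N^{k-1}·`(period-`N` coefficients of `f|γ`).
5. *The norm* (`Sturm1987_congruenceBound_Gamma1_modPrime_holds`; Murty §4): with coset
   representatives `γ_q` of `Γ₁(N)\SL₂(ℤ)` and `𝔪`-primitive normalisations `s_q` of the pushed
   translates, the series `Ψ = F · ∏_{q ≠ 1} s_q N^{k-1} (f|γ_q)_N` (`F` the period-`N` expansion of
   `f`) is the period-`N` expansion of a constant multiple of Mathlib's `ModularForm.norm 𝒮ℒ f ∈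
   M_{kμ}(SL₂(ℤ))`, `μ = [SL₂(ℤ):Γ₁(N)]`; its `𝔪`-order is finite and `≥ N·m₀` where `m₀ > kμ/12`
   is the first index with `p ∤ z_{m₀}`, so the level-one coefficients up to the Sturm bound lie in
   `𝔪`, hence (step 1 with `P = 𝔪`) all of them do — contradiction.

## References

* [Sturm1987] J. Sturm, *On the congruence of modular forms*, LNM 1240 (1987), 275–280, Thm. 1.
* [Murty1997Congruences] M. Ram Murty, *Congruences between modular forms*, LMS Lecture Note
  Ser. 247 (1997), 309–320, Thm. 5, Prop. 6, §§2–4.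
* [DeligneSerreASENS1974] P. Deligne, J.-P. Serre, *Formes modulaires de poids 1*, Ann. Sci. ÉNS (4)
  7 (1974), Prop. 2.7.
* G. Shimura, *Introduction to the arithmetic theory of automorphic functions* (1971), Thm. 3.52.
-/

noncomputable section

open UpperHalfPlane hiding I
open ModularForm Complex Filter CongruenceSubgroup ModularFormClass
open scoped MatrixGroups Topology Real Manifold

namespace Literature.NumberTheory.ModularForms

open Literature.NumberTheory.EllipticCurves.ModularForms
  (exists_int_map_eq_qExpansion_E₄ exists_int_map_eq_qExpansion_E₆)
open Literature.NumberTheory.Automorphic (exists_discriminant_qExpansion_eq_map)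

/-! ### Sturm's theorem at level one, for an additive subgroup of `ℂ` -/

section LevelOne

/-- For every even `k ≥ 0`, `k ≠ 2`, the level-one form `E₄^a E₆^b` (`4a + 6b = k`) has weight
`k` and an integral `q`-expansion with constant term `1`. [folklore] -/
theorem exists_levelOne_int_qExpansion_constantCoeff_one {k : ℕ} (hk : Even k) (hk2 : k ≠ 2) :
    ∃ (E : ModularForm 𝒮ℒ (k : ℤ)) (E₀ : PowerSeries ℤ), PowerSeries.constantCoeff E₀ = 1 ∧
      E₀.map (Int.castRingHom ℂ) = qExpansion 1 ⇑E := by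
  obtain ⟨a, b, hab⟩ : ∃ a b : ℕ, 4 * a + 6 * b = k := by
    obtain ⟨m, rfl⟩ := hk
    rcases Nat.even_or_odd m with ⟨j, rfl⟩ | ⟨j, rfl⟩
    · exact ⟨j, 0, by omega⟩
    · exact ⟨j - 1, 1, by omega⟩
  obtain ⟨P₄, hP₄1, hP₄⟩ := exists_int_map_eq_qExpansion_E₄
  obtain ⟨P₆, hP₆1, hP₆⟩ := exists_int_map_eq_qExpansion_E₆
  refine ⟨ModularForm.mcast (by rw [← hab]; push_cast; ring) ((E₄.pow a).mul (E₆.pow b)),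
    P₄ ^ a * P₆ ^ b, by simp [hP₄1, hP₆1], ?_⟩
  rw [ModularForm.qExpansion_mcast, ModularForm.qExpansion_mul one_pos one_mem_strictPeriods_SL,
    ModularForm.qExpansion_pow one_pos one_mem_strictPeriods_SL,
    ModularForm.qExpansion_pow one_pos one_mem_strictPeriods_SL, map_mul, map_pow, map_pow, hP₄,
    hP₆]

/-- The coefficients of the image of an integer power series are integer multiples of `1`, so
`z • x ∈ P` bookkeeping: `(coeff n (P₀.map _)) * x = (coeff n P₀) • x`. [folklore] -/
theorem coeff_map_intCast_mul_eq_zsmul (P₀ : PowerSeries ℤ) (n : ℕ) (x : ℂ) :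
    PowerSeries.coeff n (P₀.map (Int.castRingHom ℂ)) * x = (PowerSeries.coeff n P₀) • x := by
  rw [PowerSeries.coeff_map, eq_intCast, zsmul_eq_mul]

/-- **Sturm's theorem at level one, additive form.** Let `P ⊆ ℂ` be any additive subgroup and
`G ∈ M_k(SL₂(ℤ))` (`k ≥ 0`). If the `q`-expansion coefficients `bₙ`, `n ≤ ⌊k/12⌋`, lie in `P`,
then every `bₙ` lies in `P`: by induction on `k`, writing `G = b₀ E₄^a E₆^b + Δ H` with
`H ∈ M_{k-12}(SL₂(ℤ))` (Mathlib's `CuspForm.discriminantEquiv`), `E₄^a E₆^b ∈ 1 + qℤ⟦q⟧`,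
`Δ ∈ q + q²ℤ⟦q⟧`; the coefficients `hₙ`, `n ≤ ⌊k/12⌋ - 1`, of `H` lie in `P` by a triangular
recursion, so all of them do. (With `P = 𝔭` a prime this is the level-one case of Sturm 1987,
Thm. 1; Murty 1997, Prop. 6.) [cite: Sturm1987, Thm. 1] [cite: Murty1997Congruences, Prop. 6] -/
theorem levelOne_qExpansion_coeff_mem_nat (P : AddSubgroup ℂ) (k : ℕ) (G : ModularForm 𝒮ℒ (k : ℤ))
    (hG : ∀ n ≤ k / 12, PowerSeries.coeff n (qExpansion 1 ⇑G) ∈ P) (n : ℕ) :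
    PowerSeries.coeff n (qExpansion 1 ⇑G) ∈ P := by
  induction k using Nat.strong_induction_on generalizing n with | _ k ih => ?_
  -- the weights with `M_k = 0`
  by_cases hG0 : G = 0
  · rw [hG0]
    change PowerSeries.coeff n (qExpansion 1 (0 : ℍ → ℂ)) ∈ P
    rw [qExpansion_zero, map_zero]
    exact P.zero_mem
  have heven : Even k := by
    rcases Nat.even_or_odd k with h | h
    · exact h
    · exact absurd (ModularForm.levelOne_odd_weight_eq_zero (by exact_mod_cast h) G) hG0
  have hk2 : k ≠ 2 := by
    rintro rfl
    exact hG0 (rank_zero_iff_forall_zero.mp ModularForm.levelOne_weight_two_rank_zero G)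
  obtain ⟨E, E₀, hE₀1, hE₀⟩ := exists_levelOne_int_qExpansion_constantCoeff_one heven hk2
  obtain ⟨D, hD⟩ := exists_discriminant_qExpansion_eq_map
  -- `G' = G - b₀ E` has vanishing constant term
  set b₀ : ℂ := PowerSeries.coeff 0 (qExpansion 1 ⇑G) with hb₀_def
  have hb₀ : b₀ ∈ P := hG 0 (Nat.zero_le _)
  set G' : ModularForm 𝒮ℒ (k : ℤ) := G - b₀ • E with hG'_def
  have hcoeG' : (⇑G' : ℍ → ℂ) = ⇑G - b₀ • ⇑E := rfl
  have hqG' : qExpansion 1 ⇑G' = qExpansion 1 ⇑G - b₀ • qExpansion 1 ⇑E := by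
    rw [hcoeG', ← ModularForm.qExpansion_smul one_pos one_mem_strictPeriods_SL b₀ E,
      ← IsGLPos.coe_smul]
    exact ModularForm.qExpansion_sub one_pos one_mem_strictPeriods_SL G (b₀ • E)
  have hE₀0 : PowerSeries.coeff 0 E₀ = 1 := by
    rw [PowerSeries.coeff_zero_eq_constantCoeff]; exact hE₀1
  have hG'0 : PowerSeries.coeff 0 (qExpansion 1 ⇑G') = 0 := by
    rw [hqG', map_sub, map_smul, ← hE₀, PowerSeries.coeff_map, hE₀0, map_one, smul_eq_mul, mul_one]
    exact sub_self _
  -- `G' = Δ H`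
  set H : ModularForm 𝒮ℒ ((k : ℤ) - 12) := CuspForm.discriminantEquiv (toCuspForm G' hG'0) with hH
  have hfac : qExpansion 1 ⇑G' = qExpansion 1 ModularForm.discriminant * qExpansion 1 ⇑H :=
    ModularForm.qExpansion_eq_qExpansion_discriminant_mul G' hG'0
  -- notation for coefficients
  set g' : ℕ → ℂ := fun m ↦ PowerSeries.coeff m (qExpansion 1 ⇑G') with hg'
  set h : ℕ → ℂ := fun m ↦ PowerSeries.coeff m (qExpansion 1 ⇑H) with hh
  have hD0 : PowerSeries.coeff 0 D = 0 := by
    have h0 : PowerSeries.coeff 0 (qExpansion 1 ModularForm.discriminant) = 0 :=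
      CuspFormClass.qExpansion_coeff_zero CuspForm.discriminant one_pos one_mem_strictPeriods_SL
    rw [hD, PowerSeries.coeff_map, eq_intCast, Int.cast_eq_zero] at h0
    exact h0
  have hD1 : PowerSeries.coeff 1 D = 1 := by
    have h1 := ModularForm.discriminant_qExpansion_coeff_one
    rw [hD, PowerSeries.coeff_map, eq_intCast, Int.cast_eq_one] at h1
    exact h1
  -- the recursion `g'_{m+1} = h_m + ∑_{i=2}^{m+1} D_i h_{m+1-i}`
  have hrec : ∀ m, g' (m + 1) = h m +
      ∑ i ∈ Finset.Ico 2 (m + 2), (PowerSeries.coeff i D) • h (m + 1 - i) := by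
    intro m
    simp only [hg', hh]
    rw [hfac, hD, PowerSeries.coeff_mul, Finset.Nat.sum_antidiagonal_eq_sum_range_succ
      (fun i j ↦ PowerSeries.coeff i (D.map (Int.castRingHom ℂ)) *
        PowerSeries.coeff j (qExpansion 1 ⇑H)),
      Finset.sum_range_succ', Finset.sum_range_succ']
    simp only [coeff_map_intCast_mul_eq_zsmul, hD0, hD1, zero_smul, add_zero, one_smul,
      Nat.sub_zero, show m + 1 - (0 + 1) = m from rfl]
    rw [add_comm]
    congr 1
    rw [Finset.range_eq_Ico, Finset.sum_Ico_add' (fun i ↦ (PowerSeries.coeff i D) •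
      PowerSeries.coeff (m + 1 - i) (qExpansion 1 ⇑H)) 0 m 2]
  -- the coefficients of `G'` up to the Sturm bound lie in `P`
  have hcoeffG : ∀ m,
      PowerSeries.coeff m (qExpansion 1 ⇑G) = g' m + (PowerSeries.coeff m E₀) • b₀ := by
    intro m
    simp only [hg']
    rw [hqG', map_sub, map_smul, ← hE₀, PowerSeries.coeff_map, eq_intCast, smul_eq_mul,
      zsmul_eq_mul]
    ring
  have hg'P : ∀ m ≤ k / 12, g' m ∈ P := by
    intro m hm
    have e : g' m = PowerSeries.coeff m (qExpansion 1 ⇑G) - (PowerSeries.coeff m E₀) • b₀ := by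
      rw [hcoeffG m, add_sub_cancel_right]
    rw [e]
    exact P.sub_mem (hG m hm) (P.zsmul_mem hb₀ _)
  -- all coefficients of `H` lie in `P`
  have hhP : ∀ m, h m ∈ P := by
    by_cases hk12 : k < 12
    · have hH0 : (⇑H : ℍ → ℂ) = 0 := levelOne_neg_weight_eq_zero (by omega) H
      intro m
      simp only [hh]
      rw [hH0, qExpansion_zero, map_zero]
      exact P.zero_mem
    · push Not at hk12
      have hsmall : ∀ m ≤ (k - 12) / 12, h m ∈ P := by
        intro m
        induction m using Nat.strong_induction_on with | _ m ihm => ?_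
        intro hm
        have e : h m = g' (m + 1) -
            ∑ i ∈ Finset.Ico 2 (m + 2), (PowerSeries.coeff i D) • h (m + 1 - i) := by
          rw [hrec m, add_sub_cancel_right]
        rw [e]
        refine P.sub_mem (hg'P (m + 1) (by omega)) (sum_mem fun i hi ↦ ?_)
        rw [Finset.mem_Ico] at hi
        exact P.zsmul_mem (ihm (m + 1 - i) (by omega) (by omega)) _
      set H' : ModularForm 𝒮ℒ ((k - 12 : ℕ) : ℤ) := H.mcast (by omega) with hH'
      have hqH' : qExpansion 1 ⇑H' = qExpansion 1 ⇑H := ModularForm.qExpansion_mcast _ _ H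
      intro m
      have := ih (k - 12) (by omega) H' (fun n hn ↦ by rw [hqH']; exact hsmall n hn) m
      rwa [hqH'] at this
  -- hence all coefficients of `G' = Δ H`, and of `G`, lie in `P`
  have hg'all : ∀ m, g' m ∈ P := by
    intro m
    simp only [hg']
    rw [hfac, hD, PowerSeries.coeff_mul]
    refine sum_mem fun ij _ ↦ ?_
    rw [coeff_map_intCast_mul_eq_zsmul]
    exact P.zsmul_mem (hhP ij.2) _
  rw [hcoeffG n]
  exact P.add_mem (hg'all n) (P.zsmul_mem hb₀ _)

/-- **Sturm's theorem at level one, additive form, integer weight.** For an additive subgroup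
`P ⊆ ℂ` and `G ∈ M_k(SL₂(ℤ))`, `k : ℤ`: if `bₙ ∈ P` for all `n ≤ ⌊k/12⌋` (with `k.toNat`), then
`bₙ ∈ P` for all `n` (negative weights carry only the zero form). [cite: Sturm1987, Thm. 1] -/
theorem levelOne_qExpansion_coeff_mem (P : AddSubgroup ℂ) {k : ℤ} (G : ModularForm 𝒮ℒ k)
    (hG : ∀ n ≤ k.toNat / 12, PowerSeries.coeff n (qExpansion 1 ⇑G) ∈ P) (n : ℕ) :
    PowerSeries.coeff n (qExpansion 1 ⇑G) ∈ P := by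
  rcases lt_or_ge k 0 with hk | hk
  · rw [levelOne_neg_weight_eq_zero hk G, qExpansion_zero, map_zero]
    exact P.zero_mem
  · lift k to ℕ using hk
    exact levelOne_qExpansion_coeff_mem_nat P k G (by simpa using hG) n

end LevelOne

/-! ### A valuation ring of `ℂ` above `p`, and `p`-adic orders of `q`-series -/

section Valuation

/-- **Chevalley**: for every prime `p` there is a valuation subring `V ⊆ ℂ` (with `Frac V = ℂ`)
whose maximal ideal contains `p` (Mathlib's `Ideal.image_subset_nonunits_valuationSubring`
applied to the ideal `(p)` of `ℤ ⊆ ℂ`). It plays the role of the prime `𝔓 ∣ 𝔭` of a large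
number field in Sturm's argument (Murty 1997, §4). [folklore] -/
theorem exists_valuationSubring_natCast_mem_nonunits {p : ℕ} (hp : p.Prime) :
    ∃ V : ValuationSubring ℂ, (p : ℂ) ∈ V.nonunits := by
  let A : Subring ℂ := ⊥
  have hpA : (p : ℂ) ∈ A := natCast_mem A p
  let x : A := ⟨p, hpA⟩
  have hI : Ideal.span {x} ≠ ⊤ := by
    rw [Ne, Ideal.span_singleton_eq_top]
    rintro ⟨u, hu⟩
    obtain ⟨n, hn⟩ := Subring.mem_bot.mp ((u⁻¹ : Aˣ) : A).2
    have h1 : ((x : A) : ℂ) * (((u⁻¹ : Aˣ) : A) : ℂ) = 1 := by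
      rw [← hu, ← Subring.coe_mul, Units.mul_inv, Subring.coe_one]
    rw [← hn] at h1
    have h1' : (p : ℂ) * (n : ℂ) = 1 := h1
    have h2 : (p : ℤ) * n = 1 := by exact_mod_cast h1'
    have h3 := Int.eq_one_of_mul_eq_one_right (by positivity) h2
    have h4 : p = 1 := by exact_mod_cast h3
    exact hp.one_lt.ne' h4
  obtain ⟨V, -, hV⟩ := Ideal.image_subset_nonunits_valuationSubring (Ideal.span {x}) hI
  exact ⟨V, hV ⟨x, Ideal.subset_span rfl, rfl⟩⟩

variable {V : ValuationSubring ℂ}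

/-- Elements of the maximal ideal of `V` lie in `V`. [folklore] -/
theorem mem_of_mem_nonunits {x : ℂ} (hx : x ∈ V.nonunits) : x ∈ V :=
  (ValuationSubring.mem_nonunits_iff_exists_mem_maximalIdeal.mp hx).1

/-- `V.nonunits` is the maximal ideal: closed under addition. [folklore] -/
theorem add_mem_nonunits {x y : ℂ} (hx : x ∈ V.nonunits) (hy : y ∈ V.nonunits) :
    x + y ∈ V.nonunits := by
  rw [ValuationSubring.mem_nonunits_iff_exists_mem_maximalIdeal] at hx hy ⊢
  obtain ⟨hx, hx'⟩ := hx
  obtain ⟨hy, hy'⟩ := hy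
  exact ⟨add_mem hx hy, Ideal.add_mem _ hx' hy'⟩

/-- `0 ∈ V.nonunits`. [folklore] -/
theorem zero_mem_nonunits : (0 : ℂ) ∈ V.nonunits :=
  ValuationSubring.mem_nonunits_iff_exists_mem_maximalIdeal.mpr ⟨zero_mem V, Ideal.zero_mem _⟩

/-- `V.nonunits` is closed under negation. [folklore] -/
theorem neg_mem_nonunits {x : ℂ} (hx : x ∈ V.nonunits) : -x ∈ V.nonunits := by
  rw [ValuationSubring.mem_nonunits_iff_exists_mem_maximalIdeal] at hx ⊢
  obtain ⟨hx, hx'⟩ := hx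
  exact ⟨neg_mem hx, Submodule.neg_mem _ hx'⟩

/-- `V.nonunits` absorbs multiplication by `V`. [folklore] -/
theorem mul_mem_nonunits_of_mem {x y : ℂ} (hx : x ∈ V) (hy : y ∈ V.nonunits) :
    x * y ∈ V.nonunits := by
  rw [ValuationSubring.mem_nonunits_iff_exists_mem_maximalIdeal] at hy ⊢
  obtain ⟨hy, hy'⟩ := hy
  exact ⟨mul_mem hx hy, Ideal.mul_mem_left _ ⟨x, hx⟩ hy'⟩

/-- `1 ∉ V.nonunits`. [folklore] -/
theorem one_not_mem_nonunits : (1 : ℂ) ∉ V.nonunits := by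
  rw [ValuationSubring.mem_nonunits_iff_exists_mem_maximalIdeal]
  rintro ⟨h1, h1'⟩
  exact (Ideal.ne_top_iff_one _).mp (IsLocalRing.maximalIdeal.isMaximal V).ne_top h1'

/-- The maximal ideal is prime: a product of two elements of `V` outside it stays outside.
[folklore] -/
theorem mul_not_mem_nonunits {x y : ℂ} (hx : x ∈ V) (hy : y ∈ V) (hx' : x ∉ V.nonunits)
    (hy' : y ∉ V.nonunits) : x * y ∉ V.nonunits := by
  intro hxy
  rw [ValuationSubring.mem_nonunits_iff_exists_mem_maximalIdeal] at hxy hx' hy'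
  obtain ⟨hxyV, hxy⟩ := hxy
  rcases (IsLocalRing.maximalIdeal.isMaximal V).isPrime.mem_or_mem
    (show (⟨x, hx⟩ * ⟨y, hy⟩ : V) ∈ IsLocalRing.maximalIdeal V from hxy) with h | h
  · exact hx' ⟨hx, h⟩
  · exact hy' ⟨hy, h⟩

/-- The maximal ideal as an additive subgroup of `ℂ` (for the level-one lemma). [folklore] -/
theorem exists_addSubgroup_eq_nonunits (V : ValuationSubring ℂ) :
    ∃ P : AddSubgroup ℂ, ∀ x, x ∈ P ↔ x ∈ V.nonunits :=
  ⟨{ carrier := {x | x ∈ V.nonunits}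
     add_mem' := fun hx hy ↦ add_mem_nonunits hx hy
     zero_mem' := zero_mem_nonunits
     neg_mem' := fun hx ↦ neg_mem_nonunits hx }, fun _ ↦ Iff.rfl⟩

/-- If the prime `p` lies in the maximal ideal, an integer lies in it iff `p` divides it.
[folklore] -/
theorem intCast_mem_nonunits_iff {p : ℕ} (hp : p.Prime) (hpV : (p : ℂ) ∈ V.nonunits) (z : ℤ) :
    (z : ℂ) ∈ V.nonunits ↔ (p : ℤ) ∣ z := by
  constructor
  · intro hz
    by_contra hnd
    obtain ⟨a, b, hab⟩ := (Nat.prime_iff_prime_int.mp hp).coprime_iff_not_dvd.mpr hnd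
    apply one_not_mem_nonunits (V := V)
    have e : (1 : ℂ) = a * p + b * z := by exact_mod_cast congrArg (Int.cast (R := ℂ)) hab.symm
    rw [e]
    exact add_mem_nonunits (mul_mem_nonunits_of_mem (intCast_mem V a) hpV)
      (mul_mem_nonunits_of_mem (intCast_mem V b) hz)
  · rintro ⟨m, rfl⟩
    rw [Int.cast_mul, mul_comm]
    exact mul_mem_nonunits_of_mem (intCast_mem V m) hpV

/-- In a valuation ring, among finitely many elements (not all zero) one divides all the others.
[folklore] -/
theorem exists_div_mem_valuationSubring {ι : Type*} [Fintype ι] (c : ι → ℂ) (hc : c ≠ 0) :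
    ∃ j₀, c j₀ ≠ 0 ∧ ∀ j, c j / c j₀ ∈ V := by
  classical
  obtain ⟨j₁, hj₁⟩ : ∃ j, c j ≠ 0 := by
    by_contra h
    push Not at h
    exact hc (funext h)
  obtain ⟨j₀, -, hj₀⟩ := Finset.exists_max_image Finset.univ (fun j ↦ V.valuation (c j))
    ⟨j₁, Finset.mem_univ _⟩
  have h0 : c j₀ ≠ 0 := by
    intro h
    have := hj₀ j₁ (Finset.mem_univ _)
    rw [h, map_zero, le_zero_iff, map_eq_zero] at this
    exact hj₁ this
  refine ⟨j₀, h0, fun j ↦ ?_⟩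
  rw [← V.valuation_le_one_iff, map_div₀, div_le_one₀ ((Valuation.pos_iff _).mpr h0)]
  exact hj₀ j (Finset.mem_univ _)

/-! #### `p`-adic orders of power series with coefficients in `V` -/

/-- If `A, B ∈ V⟦q⟧` have `𝔪`-orders exactly `a` and `b` (first coefficient outside the maximal
ideal), then `A B` has `𝔪`-order exactly `a + b` — the residue ring `(V/𝔪)⟦q⟧` is a domain
(Murty 1997, §2: `ord_𝔭(fg) = ord_𝔭(f) + ord_𝔭(g)`). [folklore] -/
theorem ordP_mul {A B : PowerSeries ℂ} {a b : ℕ} (hA : ∀ n, PowerSeries.coeff n A ∈ V)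
    (hB : ∀ n, PowerSeries.coeff n B ∈ V)
    (hAa : (∀ i < a, PowerSeries.coeff i A ∈ V.nonunits) ∧ PowerSeries.coeff a A ∉ V.nonunits)
    (hBb : (∀ i < b, PowerSeries.coeff i B ∈ V.nonunits) ∧ PowerSeries.coeff b B ∉ V.nonunits) :
    (∀ n, PowerSeries.coeff n (A * B) ∈ V) ∧
      (∀ i < a + b, PowerSeries.coeff i (A * B) ∈ V.nonunits) ∧
        PowerSeries.coeff (a + b) (A * B) ∉ V.nonunits := by
  obtain ⟨P, hP⟩ := exists_addSubgroup_eq_nonunits V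
  have hmul : ∀ n, PowerSeries.coeff n (A * B) =
      ∑ j ∈ Finset.range (n + 1), PowerSeries.coeff j A * PowerSeries.coeff (n - j) B := fun n ↦ by
    rw [PowerSeries.coeff_mul, Finset.Nat.sum_antidiagonal_eq_sum_range_succ
      (fun i j ↦ PowerSeries.coeff i A * PowerSeries.coeff j B)]
  refine ⟨fun n ↦ ?_, fun i hi ↦ ?_, ?_⟩
  · rw [hmul]
    exact sum_mem fun j _ ↦ mul_mem (hA _) (hB _)
  · rw [hmul, ← hP]
    refine sum_mem fun j hj ↦ (hP _).mpr ?_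
    have hj' := Finset.mem_range.mp hj
    rcases lt_or_ge j a with h1 | h1
    · rw [mul_comm]; exact mul_mem_nonunits_of_mem (hB _) (hAa.1 _ h1)
    · exact mul_mem_nonunits_of_mem (hA _) (hBb.1 _ (by omega))
  · rw [hmul, ← Finset.add_sum_erase _ _ (by simp : a ∈ Finset.range (a + b + 1)),
      Nat.add_sub_cancel_left]
    intro hsum
    have hrest : ∑ j ∈ (Finset.range (a + b + 1)).erase a,
        PowerSeries.coeff j A * PowerSeries.coeff (a + b - j) B ∈ V.nonunits := by
      rw [← hP]
      refine sum_mem fun j hj ↦ (hP _).mpr ?_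
      obtain ⟨hne, hj'⟩ := Finset.mem_erase.mp hj
      have hj'' := Finset.mem_range.mp hj'
      rcases lt_or_ge j a with h1 | h1
      · rw [mul_comm]; exact mul_mem_nonunits_of_mem (hB _) (hAa.1 _ h1)
      · exact mul_mem_nonunits_of_mem (hA _) (hBb.1 _ (by omega))
    have hab : PowerSeries.coeff a A * PowerSeries.coeff b B ∈ V.nonunits := by
      have := add_mem_nonunits hsum (neg_mem_nonunits hrest)
      rwa [add_neg_cancel_right] at this
    exact mul_not_mem_nonunits (hA a) (hB b) hAa.2 hBb.2 hab

/-- A series over `V` with some coefficient outside the maximal ideal has an `𝔪`-order.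
[folklore] -/
theorem exists_ordP {A : PowerSeries ℂ} (h : ∃ n, PowerSeries.coeff n A ∉ V.nonunits) :
    ∃ a, (∀ i < a, PowerSeries.coeff i A ∈ V.nonunits) ∧ PowerSeries.coeff a A ∉ V.nonunits := by
  classical
  exact ⟨Nat.find h, fun i hi ↦ not_not.mp (Nat.find_min h hi), Nat.find_spec h⟩

/-- `𝔪`-orders of finite products over `V⟦q⟧` add up. [folklore] -/
theorem ordP_prod {ι : Type*} (s : Finset ι) (A : ι → PowerSeries ℂ) (a : ι → ℕ)
    (hA : ∀ i ∈ s, ∀ n, PowerSeries.coeff n (A i) ∈ V)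
    (ha : ∀ i ∈ s, (∀ j < a i, PowerSeries.coeff j (A i) ∈ V.nonunits) ∧
      PowerSeries.coeff (a i) (A i) ∉ V.nonunits) :
    (∀ n, PowerSeries.coeff n (∏ i ∈ s, A i) ∈ V) ∧
      (∀ j < ∑ i ∈ s, a i, PowerSeries.coeff j (∏ i ∈ s, A i) ∈ V.nonunits) ∧
        PowerSeries.coeff (∑ i ∈ s, a i) (∏ i ∈ s, A i) ∉ V.nonunits := by
  classical
  induction s using Finset.induction_on with
  | empty =>
    refine ⟨fun n ↦ ?_, fun j hj ↦ ?_, ?_⟩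
    · rw [Finset.prod_empty, PowerSeries.coeff_one]
      split_ifs
      · exact one_mem V
      · exact zero_mem V
    · simp at hj
    · rw [Finset.prod_empty, Finset.sum_empty, PowerSeries.coeff_one, if_pos rfl]
      exact one_not_mem_nonunits
  | insert x s hx ih =>
    obtain ⟨h1, h2, h3⟩ := ih (fun i hi ↦ hA i (Finset.mem_insert_of_mem hi))
      (fun i hi ↦ ha i (Finset.mem_insert_of_mem hi))
    rw [Finset.prod_insert hx, Finset.sum_insert hx]
    exact ordP_mul (hA x (Finset.mem_insert_self _ _)) h1 (ha x (Finset.mem_insert_self _ _))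
      ⟨h2, h3⟩

end Valuation

/-! ### Integral cusp forms on `Γ₁(M)` and `p`-primitive normalisation of an arbitrary cusp form -/

section Lattice

open Literature.NumberTheory.EllipticCurves.ModularForms

variable {M : ℕ} {k : ℤ}

/-- The `ℤ`-module of cusp forms on `Γ₁(M)` with integral Fourier coefficients is finitely
generated: finitely many coefficients embed it into `ℤ^B` by the cuspidal Sturm bound (same proof
as the tree's `integralLattice1_fg`, Deligne–Serre 1974, (2.7.1)). [folklore] -/
theorem fg_of_forall_mem_iff_int_cuspCoeff [NeZero M] (L : Submodule ℤ (CuspForm (Gamma1 M) k))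
    (hL : ∀ f, f ∈ L ↔ ∀ n, ∃ z : ℤ, (z : ℂ) = cuspCoeff f n) : L.FG := by
  classical
  set B : ℕ := ((k * Nat.card (𝒮ℒ ⧸ (Gamma1 M : Subgroup (GL (Fin 2) ℝ)).subgroupOf 𝒮ℒ)).toNat / 12
    : ℕ) + 2 with hB
  let Φ : CuspForm (Gamma1 M) k →ₗ[ℂ] (Fin B → ℂ) :=
    LinearMap.pi fun j ↦ cuspCoeffₗ (HeckeTGamma1.one_mem_strictPeriods_Gamma1 M) (j : ℕ)
  have hΦ : Function.Injective Φ := by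
    rw [injective_iff_map_eq_zero]
    intro f hf
    refine cuspForm_eq_zero_of_qExpansion_coeff_eq_zero
      (HeckeTGamma1.one_mem_strictPeriods_Gamma1 M) f (m := B) (fun i hi ↦ ?_) (by omega)
    exact congr_fun hf ⟨i, hi⟩
  let T : (Fin B → ℤ) →ₗ[ℤ] (Fin B → ℂ) := (Algebra.linearMap ℤ ℂ).compLeft (Fin B)
  have hle : L.map (Φ.restrictScalars ℤ) ≤ LinearMap.range T := by
    rintro _ ⟨f, hf, rfl⟩
    choose z hz using (hL f).mp hf
    refine ⟨fun j ↦ z j, ?_⟩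
    funext j
    simp [T, Φ, hz]
  have hfgT : (L.map (Φ.restrictScalars ℤ)).FG := by
    rw [← Submodule.map_comap_eq_self hle]
    exact (IsNoetherian.noetherian _).map T
  exact Submodule.fg_of_fg_map_injective (Φ.restrictScalars ℤ) (fun a b h ↦ hΦ h) hfgT

/-- **Deligne–Serre 1974, (2.7.2), naive lattice**: for `k ≥ 1` the cusp forms on `Γ₁(M)` with
integral Fourier coefficients span `S_k(Γ₁(M))` over `ℂ` — they contain Deligne–Serre's lattice
`L` (all diamond twists integral), which spans by the tree's theorem
`DeligneSerre1974_span_integralLattice1_holds` (Shimura 1971, Thm. 3.52 for `Γ₁(N)`).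
[cite: DeligneSerreASENS1974, Prop. 2.7 (2.7.2)] -/
theorem span_eq_top_of_forall_mem_iff_int_cuspCoeff [NeZero M]
    (L : Submodule ℤ (CuspForm (Gamma1 M) k))
    (hL : ∀ f, f ∈ L ↔ ∀ n, ∃ z : ℤ, (z : ℂ) = cuspCoeff f n) (hk : 1 ≤ k) :
    Submodule.span ℂ (L : Set (CuspForm (Gamma1 M) k)) = ⊤ := by
  apply top_unique
  rw [← DeligneSerre1974_span_integralLattice1_holds M k hk]
  refine Submodule.span_mono fun f hf ↦ ?_
  exact (hL f).mpr (exists_int_eq_cuspCoeff_of_mem_integralLattice1 hf)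

/-- Fourier coefficients of a finite `ℂ`-linear combination of cusp forms. [folklore] -/
theorem cuspCoeff_sum_smul {ι : Type*} (s : Finset ι) (c : ι → ℂ) (g : ι → CuspForm (Gamma1 M) k)
    (n : ℕ) : cuspCoeff (∑ j ∈ s, c j • g j) n = ∑ j ∈ s, c j * cuspCoeff (g j) n := by
  rw [← cuspCoeffₗ_apply (HeckeTGamma1.one_mem_strictPeriods_Gamma1 M), map_sum]
  exact Finset.sum_congr rfl fun j _ ↦ by rw [map_smul, cuspCoeffₗ_apply, smul_eq_mul]

/-- Fourier coefficients of a finite `ℤ`-linear combination of cusp forms. [folklore] -/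
theorem cuspCoeff_sum_zsmul {ι : Type*} (s : Finset ι) (a : ι → ℤ) (g : ι → CuspForm (Gamma1 M) k)
    (n : ℕ) : cuspCoeff (∑ j ∈ s, a j • g j) n = ∑ j ∈ s, (a j : ℂ) * cuspCoeff (g j) n := by
  rw [← cuspCoeffₗ_apply (HeckeTGamma1.one_mem_strictPeriods_Gamma1 M), map_sum]
  exact Finset.sum_congr rfl fun j _ ↦ by rw [map_zsmul, cuspCoeffₗ_apply, zsmul_eq_mul]

/-- Fourier coefficients of a scalar multiple. [folklore] -/
theorem cuspCoeff_smul' (c : ℂ) (g : CuspForm (Gamma1 M) k) (n : ℕ) :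
    cuspCoeff (c • g) n = c * cuspCoeff g n := by
  rw [← cuspCoeffₗ_apply (HeckeTGamma1.one_mem_strictPeriods_Gamma1 M), map_smul, cuspCoeffₗ_apply,
    smul_eq_mul]

/-- **`p`-primitive normalisation.** Let `V ⊆ ℂ` be a valuation ring whose maximal ideal `𝔪`
contains the prime `p`, and `ψ ≠ 0` a cusp form of weight `k ≥ 1` on `Γ₁(M)`. Then some scalar
multiple `s ψ` has all its Fourier coefficients in `V` and one of them outside `𝔪`. Proof: write
`ψ = ∑ cⱼ gⱼ` on a `ℤ`-basis `(gⱼ)` of the lattice of integral forms (it spans `S_k(Γ₁(M))` over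
`ℂ` by Deligne–Serre (2.7.2)), divide by a `cⱼ₀` of least valuation; if every coefficient of
`∑ (cⱼ/cⱼ₀) gⱼ` were in `𝔪`, the reductions `ḡⱼ ∈ 𝔽_p⟦q⟧` would be linearly dependent over the
residue field `V/𝔪 ⊇ 𝔽_p`, hence over `𝔽_p`; but `∑ aⱼ gⱼ ∈ p ℤ⟦q⟧` forces `p ∣ aⱼ` because
`(∑ aⱼ gⱼ)/p` is again an integral cusp form. (This replaces "bounded denominators and a prime of
`K(ζ_N)`" in Sturm's proof, Murty 1997, §4.) [folklore] -/
theorem exists_smul_cuspCoeff_mem_and_not_mem_nonunits [NeZero M] (V : ValuationSubring ℂ) {p : ℕ}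
    (hp : p.Prime) (hpV : (p : ℂ) ∈ V.nonunits) (hk : 1 ≤ k) (ψ : CuspForm (Gamma1 M) k)
    (hψ : ψ ≠ 0) :
    ∃ s : ℂ, (∀ n, s * cuspCoeff ψ n ∈ V) ∧ ∃ n, s * cuspCoeff ψ n ∉ V.nonunits := by
  classical
  haveI : Fact p.Prime := ⟨hp⟩
  -- the lattice of integral cusp forms and a `ℤ`-basis of it
  let L : Submodule ℤ (CuspForm (Gamma1 M) k) := ⨅ n : ℕ,
    (LinearMap.range (Algebra.linearMap ℤ ℂ)).comap
      ((cuspCoeffₗ (HeckeTGamma1.one_mem_strictPeriods_Gamma1 M) n).restrictScalars ℤ)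
  have hL : ∀ f, f ∈ L ↔ ∀ n, ∃ z : ℤ, (z : ℂ) = cuspCoeff f n := fun f ↦ by
    simp [L, Submodule.mem_iInf, LinearMap.mem_range]
  haveI : Module.Finite ℤ L := Module.Finite.iff_fg.mpr (fg_of_forall_mem_iff_int_cuspCoeff L hL)
  haveI : NoZeroSMulDivisors ℤ (CuspForm (Gamma1 M) k) := inferInstance
  haveI : Module.Free ℤ L := Module.free_of_finite_type_torsion_free'
  set d := Module.finrank ℤ L
  let b : Module.Basis (Fin d) ℤ L := Module.finBasis ℤ L
  let g : Fin d → CuspForm (Gamma1 M) k := fun j ↦ (b j : CuspForm (Gamma1 M) k)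
  have hcoe : ∀ a : Fin d → ℤ, ((∑ j, a j • b j : L) : CuspForm (Gamma1 M) k) = ∑ j, a j • g j :=
    fun a ↦ by simp [g]
  have hcoord : ∀ a : Fin d → ℤ, b.equivFun (∑ j, a j • b j) = a := fun a ↦ by
    rw [← b.equivFun_symm_apply, LinearEquiv.apply_symm_apply]
  -- integer coefficients of the basis
  choose zc hzc using fun j n ↦ (hL (g j)).mp (b j).2 n
  -- (i) the `ℂ`-span of the basis is everything
  have hspan : Submodule.span ℂ (Set.range g) = ⊤ := by
    apply top_unique
    rw [← span_eq_top_of_forall_mem_iff_int_cuspCoeff L hL hk, Submodule.span_le]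
    intro x hx
    have e : x = ∑ j, (b.repr (⟨x, hx⟩ : L) j) • g j := by
      rw [← hcoe, b.sum_repr (⟨x, hx⟩ : L)]
    rw [e]
    exact Submodule.sum_mem _ fun j _ ↦ zsmul_mem (Submodule.subset_span (Set.mem_range_self j)) _
  -- (ii) the reductions mod `p` of the basis are linearly independent over `𝔽_p`
  have hindep : LinearIndependent (ZMod p) (fun j ↦ fun n ↦ ((zc j n : ℤ) : ZMod p)) := by
    rw [Fintype.linearIndependent_iff]
    intro w hw j₁
    -- lift `w` to integers `a`
    let a : Fin d → ℤ := fun j ↦ ((w j).val : ℤ)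
    have ha : ∀ j, ((a j : ℤ) : ZMod p) = w j := fun j ↦ by simp [a]
    have hdvd : ∀ n, (p : ℤ) ∣ ∑ j, a j * zc j n := by
      intro n
      rw [← ZMod.intCast_zmod_eq_zero_iff_dvd]
      have := congr_fun hw n
      simp only [Finset.sum_apply, Pi.smul_apply, smul_eq_mul, Pi.zero_apply] at this
      push_cast
      simpa [ha] using this
    choose t ht using hdvd
    -- `h = ∑ aⱼ gⱼ` has coefficients `p tₙ`, so `h/p ∈ L`
    set h : CuspForm (Gamma1 M) k := ∑ j, a j • g j with hh
    have hhn : ∀ n, cuspCoeff h n = p * t n := fun n ↦ by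
      rw [hh, cuspCoeff_sum_zsmul]
      simp_rw [← hzc]
      exact_mod_cast ht n
    set h' : CuspForm (Gamma1 M) k := (p : ℂ)⁻¹ • h with hh'
    have hp0 : (p : ℂ) ≠ 0 := Nat.cast_ne_zero.mpr hp.ne_zero
    have hh'L : h' ∈ L := by
      rw [hL]
      intro n
      refine ⟨t n, ?_⟩
      rw [hh', cuspCoeff_smul', hhn, inv_mul_cancel_left₀ hp0]
    -- compare coordinates of `h = p h'` on the basis
    set e : Fin d → ℤ := b.equivFun ⟨h', hh'L⟩ with he
    have h1 : (⟨h', hh'L⟩ : L) = ∑ j, e j • b j := by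
      rw [he, ← b.equivFun_symm_apply, LinearEquiv.symm_apply_apply]
    have h2 : (∑ j, a j • b j : L) = ∑ j, ((p : ℤ) * e j) • b j := by
      apply Subtype.ext
      rw [hcoe, hcoe, ← hh]
      have : ∑ j, ((p : ℤ) * e j) • g j = (p : ℤ) • ∑ j, e j • g j := by
        rw [Finset.smul_sum]
        exact Finset.sum_congr rfl fun j _ ↦ mul_smul _ _ _
      rw [this, ← hcoe, ← h1]
      change h = (p : ℤ) • h'
      rw [hh', ← Int.cast_smul_eq_zsmul ℂ, smul_smul, Int.cast_natCast, mul_inv_cancel₀ hp0,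
        one_smul]
    have h3 := congrArg b.equivFun h2
    rw [hcoord, hcoord] at h3
    rw [← ha j₁, h3]
    push_cast
    rw [ZMod.natCast_self, zero_mul]
  -- expand `ψ` on the basis and normalise by a coefficient of least valuation
  obtain ⟨c, hc⟩ := (Submodule.mem_span_range_iff_exists_fun ℂ).mp
    (show ψ ∈ Submodule.span ℂ (Set.range g) by rw [hspan]; exact Submodule.mem_top)
  have hc0 : c ≠ 0 := by
    rintro rfl
    apply hψ
    rw [← hc]
    simp
  obtain ⟨j₀, hj₀, hcj⟩ := exists_div_mem_valuationSubring (V := V) c hc0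
  have hcoeff : ∀ n, (c j₀)⁻¹ * cuspCoeff ψ n = ∑ j, (c j / c j₀) * (zc j n : ℂ) := by
    intro n
    rw [← hc, cuspCoeff_sum_smul, Finset.mul_sum]
    refine Finset.sum_congr rfl fun j _ ↦ ?_
    rw [hzc]
    field_simp
  refine ⟨(c j₀)⁻¹, fun n ↦ ?_, ?_⟩
  · rw [hcoeff]
    exact sum_mem fun j _ ↦ mul_mem (hcj j) (intCast_mem V _)
  by_contra hall
  push Not at hall
  -- pass to the residue field `κ = V/𝔪 ⊇ 𝔽_p`
  let κ := IsLocalRing.ResidueField V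
  let θ : V →+* κ := IsLocalRing.residue V
  have hpθ : (p : κ) = 0 := by
    rw [← map_natCast θ p, IsLocalRing.residue_eq_zero_iff]
    obtain ⟨hpV', hpm⟩ := ValuationSubring.mem_nonunits_iff_exists_mem_maximalIdeal.mp hpV
    exact hpm
  haveI : CharP κ p := (CharP.charP_iff_prime_eq_zero hp).mpr hpθ
  letI : Algebra (ZMod p) κ := ZMod.algebra κ p
  let u : Fin d → V := fun j ↦ ⟨c j / c j₀, hcj j⟩
  -- every `∑ uⱼ zc j n` lies in the maximal ideal
  have hsum0 : ∀ n, θ (∑ j, u j * (zc j n : V)) = 0 := by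
    intro n
    rw [IsLocalRing.residue_eq_zero_iff]
    obtain ⟨hmem, hmax⟩ := ValuationSubring.mem_nonunits_iff_exists_mem_maximalIdeal.mp (hall n)
    have e : (((∑ j, u j * (zc j n : V) : V)) : ℂ) = (c j₀)⁻¹ * cuspCoeff ψ n := by
      rw [hcoeff n]
      simp [u]
    have e' : (∑ j, u j * (zc j n : V) : V) = ⟨_, hmem⟩ := Subtype.ext e
    rw [e']
    exact hmax
  -- hence a linear relation over `κ` between the reductions
  have hrel : ∑ j, θ (u j) • ((algebraMap (ZMod p) κ) ∘ fun n ↦ ((zc j n : ℤ) : ZMod p)) = 0 := by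
    funext n
    simp only [Finset.sum_apply, Pi.smul_apply, Function.comp_apply, smul_eq_mul, Pi.zero_apply,
      map_intCast]
    have := hsum0 n
    simpa [map_sum, map_mul, map_intCast] using this
  have hindepκ :=
    (Literature.LinearAlgebra.BaseChange.linearIndependent_algebraMap_comp_iff_of_field
      (k := ZMod p) (K := κ)).mpr hindep
  have hzero := (Fintype.linearIndependent_iff.mp hindepκ) (fun j ↦ θ (u j)) hrel j₀
  have hu : u j₀ = 1 := Subtype.ext (div_self hj₀)
  rw [hu, map_one] at hzero
  exact one_ne_zero hzero

end Lattice

/-! ### The translates `f|γ`, `γ ∈ SL₂(ℤ)`, pushed to level `Γ₁(N²)` -/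

section Translates

open Literature.NumberTheory.EllipticCurves.ModularForms Matrix.SpecialLinearGroup
open scoped Pointwise

variable (N : ℕ)

/-- `Γ(N) ≤ Γ₁(N)`. [folklore] -/
theorem Gamma_le_Gamma1 : CongruenceSubgroup.Gamma N ≤ Gamma1 N := by
  intro A hA
  rw [Gamma_mem] at hA
  rw [Gamma1_mem]
  exact ⟨hA.1, hA.2.2.2, hA.2.2.1⟩

/-- `T^N ∈ Γ(N)`. [folklore] -/
theorem T_pow_mem_Gamma : ModularGroup.T ^ N ∈ CongruenceSubgroup.Gamma N := by
  have h := ModularGroup_T_pow_mem_Gamma (N : ℤ) (N : ℤ) dvd_rfl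
  rwa [zpow_natCast, Int.natAbs_natCast] at h

variable {N} (hN : (0 : ℚ) < N)

/-- **`α_N = diag(N, 1)` conjugates `Γ₁(N²)` into `Γ(N)`**: for `γ = (a b; c d) ∈ Γ₁(N²)`,
`α_N γ α_N⁻¹ = (a, N b; c/N, d) ∈ Γ(N)` (Diamond–Shurman Exercise 1.2.11: `f(Nτ)` has level
`Γ₁(N²)` for `f` of level `Γ(N)`; here `α_N` is the tree's `glCast (diagGL N 1)`). [folklore] -/
theorem exists_mem_Gamma_diagGL_mul_eq {γ : SL(2, ℤ)} (hγ : γ ∈ Gamma1 (N ^ 2)) :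
    ∃ γ' : SL(2, ℤ), γ' ∈ CongruenceSubgroup.Gamma N ∧
      glCast (diagGL (N : ℚ) 1 hN one_pos) * (mapGL ℝ γ : GL (Fin 2) ℝ) =
        mapGL ℝ γ' * glCast (diagGL (N : ℚ) 1 hN one_pos) := by
  have hN' : 0 < N := by exact_mod_cast hN
  rw [Gamma1_mem] at hγ
  obtain ⟨h00, h11, h10⟩ := hγ
  have hNN : (N : ℤ) * N ∣ γ 1 0 := by
    have := (ZMod.intCast_zmod_eq_zero_iff_dvd _ (N ^ 2)).mp h10
    simpa [sq] using this
  obtain ⟨c₂, hc₂⟩ := hNN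
  have hdet := Matrix.SpecialLinearGroup.det_coe γ
  rw [Matrix.det_fin_two, hc₂] at hdet
  have hdvd : N ∣ N ^ 2 := dvd_pow_self N two_ne_zero
  refine ⟨⟨!![γ 0 0, (N : ℤ) * γ 0 1; (N : ℤ) * c₂, γ 1 1], ?_⟩, ?_, ?_⟩
  · rw [Matrix.det_fin_two_of]
    linear_combination hdet
  · rw [Gamma_mem]
    refine ⟨?_, ?_, ?_, ?_⟩
    · show ((γ 0 0 : ℤ) : ZMod N) = 1
      have := congrArg (ZMod.castHom hdvd (ZMod N)) h00
      rwa [map_intCast, map_one] at this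
    · show (((N : ℤ) * γ 0 1 : ℤ) : ZMod N) = 0
      push_cast
      simp
    · show (((N : ℤ) * c₂ : ℤ) : ZMod N) = 0
      push_cast
      simp
    · show ((γ 1 1 : ℤ) : ZMod N) = 1
      have := congrArg (ZMod.castHom hdvd (ZMod N)) h11
      rwa [map_intCast, map_one] at this
  · -- the identity of real matrices, through integer matrices
    have hmat : (!![γ 0 0, (N : ℤ) * γ 0 1; (N : ℤ) * c₂, γ 1 1] : Matrix (Fin 2) (Fin 2) ℤ) *
        !![(N : ℤ), 0; 0, 1] = !![(N : ℤ), 0; 0, 1] * γ := by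
      ext i j
      fin_cases i <;> fin_cases j <;>
        simp [Matrix.mul_apply, Fin.sum_univ_two, hc₂] <;> ring
    have hD := det_diag_ne_zero (d := N) hN'.ne'
    have hγd : ((γ : SL(2, ℤ)) : Matrix (Fin 2) (Fin 2) ℤ).det ≠ 0 := by simp
    have hγ'd : (!![γ 0 0, (N : ℤ) * γ 0 1; (N : ℤ) * c₂, γ 1 1] :
        Matrix (Fin 2) (Fin 2) ℤ).det ≠ 0 := by
      rw [Matrix.det_fin_two_of]
      have : γ 0 0 * γ 1 1 - (N : ℤ) * γ 0 1 * ((N : ℤ) * c₂) = 1 := by linear_combination hdet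
      rw [this]
      exact one_ne_zero
    rw [mapGL_eq_intGL, mapGL_eq_intGL,
      show glCast (diagGL (N : ℚ) 1 hN one_pos) = intGL !![(N : ℤ), 0; 0, 1] from
        glCast_diagGL_eq_intGL hN',
      ← intGL_mul hD hγd, ← intGL_mul hγ'd hD, hmat]

/-- **`Γ₁(N) (γ α_N) Γ₁(N²) = Γ₁(N) (γ α_N)` is a single right coset** for every `γ ∈ SL₂(ℤ)`,
because `(γ α_N) Γ₁(N²) (γ α_N)⁻¹ ⊆ γ Γ(N) γ⁻¹ = Γ(N) ⊆ Γ₁(N)`. [folklore] -/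
theorem isDoubleCosetDecomp_mapGL_mul_diagGL (γ : SL(2, ℤ)) :
    IsDoubleCosetDecomp (Gamma1 N : Subgroup (GL (Fin 2) ℝ))
      (Gamma1 (N ^ 2) : Subgroup (GL (Fin 2) ℝ))
      ((mapGL ℝ γ : GL (Fin 2) ℝ) * glCast (diagGL (N : ℚ) 1 hN one_pos))
      (fun _ : Unit ↦ (mapGL ℝ γ : GL (Fin 2) ℝ) * glCast (diagGL (N : ℚ) 1 hN one_pos)) := by
  refine ⟨fun _ ↦ DoubleCoset.mem_doubleCoset.mpr ⟨1, one_mem _, 1, one_mem _, by simp⟩,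
    fun x hx ↦ ⟨(), ?_, fun _ _ ↦ rfl⟩⟩
  obtain ⟨a, ha, b, hb, rfl⟩ := DoubleCoset.mem_doubleCoset.mp hx
  obtain ⟨δ, hδ, rfl⟩ := Subgroup.mem_map.mp hb
  obtain ⟨δ', hδ', key⟩ := exists_mem_Gamma_diagGL_mul_eq hN hδ
  set D : GL (Fin 2) ℝ := glCast (diagGL (N : ℚ) 1 hN one_pos) with hD
  have e : a * ((mapGL ℝ γ : GL (Fin 2) ℝ) * D) * (mapGL ℝ δ : GL (Fin 2) ℝ) *
      ((mapGL ℝ γ : GL (Fin 2) ℝ) * D)⁻¹ = a * mapGL ℝ (γ * δ' * γ⁻¹) := by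
    rw [map_mul, map_mul, map_inv, mul_inv_rev]
    have : (mapGL ℝ γ : GL (Fin 2) ℝ) * D * (mapGL ℝ δ : GL (Fin 2) ℝ) =
        (mapGL ℝ γ : GL (Fin 2) ℝ) * (mapGL ℝ δ' : GL (Fin 2) ℝ) * D := by
      rw [mul_assoc, key, ← mul_assoc]
    rw [mul_assoc a, mul_assoc a, this]
    group
  rw [e]
  exact mul_mem ha (Subgroup.mem_map_of_mem _
    (Gamma_le_Gamma1 N ((CongruenceSubgroup.Gamma_normal N).conj_mem δ' hδ' γ)))

variable {k : ℤ}

/-- The `GL(2, ℚ)⁺` element `γ α_N` casts to `mapGL ℝ γ * α_N` in `GL(2, ℝ)`. [folklore] -/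
theorem glCast_slToGLPos_mul_diagGL (γ : SL(2, ℤ)) :
    glCast (slToGLPos γ * diagGL (N : ℚ) 1 hN one_pos) =
      (mapGL ℝ γ : GL (Fin 2) ℝ) * glCast (diagGL (N : ℚ) 1 hN one_pos) := by
  rw [show glCast ((slToGLPos γ : GL (Fin 2) ℚ) * (diagGL (N : ℚ) 1 hN one_pos : GL (Fin 2) ℚ)) =
      glCast (slToGLPos γ : GL (Fin 2) ℚ) * glCast (diagGL (N : ℚ) 1 hN one_pos) from map_mul _ _ _,
    glCast_slToGLPos]

variable [NeZero N]

/-- **The translate `f|γ` pushed to level `Γ₁(N²)`**: for `f ∈ S_k(Γ₁(N))` and `γ ∈ SL₂(ℤ)`,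
`[Γ₁(N) (γ α_N) Γ₁(N²)] f = (f|γ)|α_N ∈ S_k(Γ₁(N²))` (the double coset is a single coset).
[folklore] -/
theorem coe_cuspHeckeCorrespondence_slToGLPos_mul_diagGL (γ : SL(2, ℤ))
    (f : CuspForm (Gamma1 N) k) :
    (⇑(cuspHeckeCorrespondence (Gamma1 N) (Gamma1 (N ^ 2)) k
        (slToGLPos γ * diagGL (N : ℚ) 1 hN one_pos) f) : ℍ → ℂ) =
      (⇑f ∣[k] (mapGL ℝ γ : GL (Fin 2) ℝ)) ∣[k] glCast (diagGL (N : ℚ) 1 hN one_pos) := by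
  haveI : NeZero (N ^ 2) := ⟨pow_ne_zero 2 (NeZero.ne N)⟩
  rw [coe_cuspHeckeCorrespondence_eq_sum _ _ k _ (by
    rw [glCast_slToGLPos_mul_diagGL]; exact isDoubleCosetDecomp_mapGL_mul_diagGL hN γ) f]
  simp [SlashAction.slash_mul]

omit [NeZero N] in
/-- `𝕢_N(N τ) = 𝕢_1(τ)`. [folklore] -/
theorem qParam_natCast_mul (hN0 : (N : ℂ) ≠ 0) (τ : ℂ) :
    Function.Periodic.qParam (N : ℝ) ((N : ℂ) * τ) = Function.Periodic.qParam 1 τ := by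
  simp only [Function.Periodic.qParam, Complex.ofReal_natCast, Complex.ofReal_one, div_one]
  congr 1
  field_simp

omit [NeZero N] in
/-- `N` is a strict period of `γ⁻¹ Γ₁(N) γ` (`T^N ∈ Γ(N) ⊴ SL₂(ℤ)`), the level of the translate
`f|γ` (Mathlib `CuspForm.translate`). [folklore] -/
theorem natCast_mem_strictPeriods_conj_Gamma1 (γ : SL(2, ℤ)) :
    (N : ℝ) ∈ (ConjAct.toConjAct ((mapGL ℝ γ : GL (Fin 2) ℝ))⁻¹ •
      (Gamma1 N : Subgroup (GL (Fin 2) ℝ))).strictPeriods := by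
  rw [Subgroup.mem_strictPeriods_iff, Subgroup.mem_pointwise_smul_iff_inv_smul_mem,
    ← ConjAct.toConjAct_inv, inv_inv, ConjAct.toConjAct_smul]
  have hT : Matrix.GeneralLinearGroup.upperRightHom (N : ℝ) = mapGL ℝ (ModularGroup.T ^ N) := by
    have hTn : ((ModularGroup.T ^ N : SL(2, ℤ)) : Matrix (Fin 2) (Fin 2) ℤ) =
        !![1, (N : ℤ); 0, 1] := by
      rw [← zpow_natCast, ModularGroup.coe_T_zpow]
    rw [Units.ext_iff, mapGL_coe_matrix, map_apply_coe, hTn]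
    ext i j
    fin_cases i <;> fin_cases j <;> simp [Matrix.GeneralLinearGroup.upperRightHom]
  rw [hT, ← map_inv, ← map_mul, ← map_mul]
  exact Subgroup.mem_map_of_mem _
    (Gamma_le_Gamma1 N ((CongruenceSubgroup.Gamma_normal N).conj_mem _ (T_pow_mem_Gamma N) γ))

/-- The translate `f|γ` (`γ ∈ SL₂(ℤ)`) of `f ∈ S_k(Γ₁(N))` is `N`-periodic, holomorphic and
bounded at `i∞`. [folklore] -/
theorem nice_slash (γ : SL(2, ℤ)) (f : CuspForm (Gamma1 N) k) :
    Function.Periodic ((⇑f ∣[k] (mapGL ℝ γ : GL (Fin 2) ℝ)) ∘ ofComplex) (N : ℝ) ∧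
      MDiff (⇑f ∣[k] (mapGL ℝ γ : GL (Fin 2) ℝ)) ∧
        IsBoundedAtImInfty (⇑f ∣[k] (mapGL ℝ γ : GL (Fin 2) ℝ)) := by
  have hper := natCast_mem_strictPeriods_conj_Gamma1 (N := N) γ
  let F := CuspForm.translate f (mapGL ℝ γ : GL (Fin 2) ℝ)
  have hF : (⇑F : ℍ → ℂ) = ⇑f ∣[k] (mapGL ℝ γ : GL (Fin 2) ℝ) := rfl
  haveI : Fact (IsCusp OnePoint.infty (ConjAct.toConjAct ((mapGL ℝ γ : GL (Fin 2) ℝ))⁻¹ •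
      (Gamma1 N : Subgroup (GL (Fin 2) ℝ)))) :=
    ⟨Subgroup.isCusp_of_mem_strictPeriods (Nat.cast_pos.mpr (NeZero.pos N)) hper⟩
  rw [← hF]
  exact ⟨SlashInvariantFormClass.periodic_comp_ofComplex F hper, ModularFormClass.holo F,
    ModularFormClass.bdd_at_infty F⟩

/-- **Fourier coefficients of the pushed translate**: with `ψ = (f|γ)|α_N ∈ S_k(Γ₁(N²))`,
`aₙ(ψ) = N^{k-1} · (n`-th coefficient of the period-`N` expansion of `f|γ)`, since
`ψ(τ) = N^{k-1} (f|γ)(Nτ)` and `𝕢_N(Nτ) = 𝕢_1(τ)`. [folklore] -/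
theorem cuspCoeff_cuspHeckeCorrespondence_slToGLPos_mul_diagGL (γ : SL(2, ℤ))
    (f : CuspForm (Gamma1 N) k) (n : ℕ) :
    cuspCoeff (cuspHeckeCorrespondence (Gamma1 N) (Gamma1 (N ^ 2)) k
        (slToGLPos γ * diagGL (N : ℚ) 1 hN one_pos) f) n =
      (N : ℂ) ^ (k - 1) *
        PowerSeries.coeff n (qExpansion (N : ℝ) (⇑f ∣[k] (mapGL ℝ γ : GL (Fin 2) ℝ))) := by
  haveI : NeZero (N ^ 2) := ⟨pow_ne_zero 2 (NeZero.ne N)⟩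
  have hN' : 0 < N := NeZero.pos N
  have hN0 : (N : ℂ) ≠ 0 := Nat.cast_ne_zero.mpr hN'.ne'
  set ψ := cuspHeckeCorrespondence (Gamma1 N) (Gamma1 (N ^ 2)) k
    (slToGLPos γ * diagGL (N : ℚ) 1 hN one_pos) f with hψ_def
  set φ : ℍ → ℂ := ⇑f ∣[k] (mapGL ℝ γ : GL (Fin 2) ℝ) with hφ
  have hψτ : ∀ τ : ℍ, ψ τ = (N : ℂ) ^ (k - 1) *
      φ ⟨(N : ℂ) * τ, by simpa using mul_pos (Nat.cast_pos.mpr hN') τ.2⟩ := fun τ ↦ by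
    have h1 := smul_slash_diagGL_apply k N hN' φ τ
    rw [← coe_cuspHeckeCorrespondence_slToGLPos_mul_diagGL hN γ f, Pi.smul_apply,
      smul_eq_mul] at h1
    have h2 : ((⟨(N : ℝ), Nat.cast_pos.mpr hN'⟩ : {x : ℝ // 0 < x}) • τ : ℍ) =
        ⟨(N : ℂ) * τ, by simpa using mul_pos (Nat.cast_pos.mpr hN') τ.2⟩ := by
      apply UpperHalfPlane.ext
      simp [UpperHalfPlane.coe_pos_real_smul]
    rw [h2] at h1
    rw [← h1, ← mul_assoc, ← zpow_add₀ hN0, show k - 1 + (1 - k) = 0 by ring, zpow_zero, one_mul]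
  symm
  refine ModularFormClass.qExpansion_coeff_unique one_pos
    (HeckeTGamma1.one_mem_strictPeriods_Gamma1 (N ^ 2)) (f := ψ)
    (c := fun m ↦ (N : ℂ) ^ (k - 1) * PowerSeries.coeff m (qExpansion (N : ℝ) φ)) (fun τ ↦ ?_) n
  have hnice := nice_slash (N := N) γ f
  set τ' : ℍ := ⟨(N : ℂ) * τ, by simpa using mul_pos (Nat.cast_pos.mpr hN') τ.2⟩ with hτ'
  have hs := hasSum_qExpansion (Nat.cast_pos.mpr hN') hnice.1 hnice.2.1 hnice.2.2 τ'
  have hq : Function.Periodic.qParam (N : ℝ) (τ' : ℂ) = Function.Periodic.qParam 1 τ :=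
    qParam_natCast_mul hN0 τ
  rw [hq] at hs
  rw [hψτ τ]
  simpa only [smul_eq_mul, mul_assoc] using hs.mul_left ((N : ℂ) ^ (k - 1))

end Translates

/-! ### `q`-expansions of finite products of nice functions -/

section NiceProd

open Literature.NumberTheory.ModularForms.QExpansionAlgebra Function

/-- Finite products of nice functions are nice. [folklore] -/
theorem nice_prod {ι : Type*} (s : Finset ι) {F : ι → ℍ → ℂ} {H : ℝ}
    (hF : ∀ i ∈ s, Periodic (F i ∘ ofComplex) H ∧ MDiff (F i) ∧ IsBoundedAtImInfty (F i)) :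
    Periodic ((∏ i ∈ s, F i) ∘ ofComplex) H ∧ MDiff (∏ i ∈ s, F i) ∧
      IsBoundedAtImInfty (∏ i ∈ s, F i) := by
  classical
  induction s using Finset.induction_on with
  | empty =>
    rw [Finset.prod_empty]
    exact nice_const 1 H
  | insert a s ha ih =>
    rw [Finset.prod_insert ha]
    exact nice_mul (hF a (Finset.mem_insert_self a s))
      (ih fun i hi ↦ hF i (Finset.mem_insert_of_mem hi))

/-- `qExpansion` of a finite product of nice functions. [folklore] -/
theorem qExpansion_prod_of_nice {ι : Type*} (s : Finset ι) {F : ι → ℍ → ℂ} {H : ℝ} (hH : 0 < H)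
    (hF : ∀ i ∈ s, Periodic (F i ∘ ofComplex) H ∧ MDiff (F i) ∧ IsBoundedAtImInfty (F i)) :
    qExpansion H (∏ i ∈ s, F i) = ∏ i ∈ s, qExpansion H (F i) := by
  classical
  induction s using Finset.induction_on with
  | empty =>
    rw [Finset.prod_empty, Finset.prod_empty]
    exact qExpansion_one H
  | insert a s ha ih =>
    rw [Finset.prod_insert ha, Finset.prod_insert ha,
      qExpansion_mul_of_nice hH (hF a (Finset.mem_insert_self a s))
        (nice_prod s fun i hi ↦ hF i (Finset.mem_insert_of_mem hi)),
      ih fun i hi ↦ hF i (Finset.mem_insert_of_mem hi)]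

end NiceProd

/-! ### Sturm's theorem for `Γ₁(N)`: the discharge -/

section Main

open Literature.NumberTheory.EllipticCurves.ModularForms Matrix.SpecialLinearGroup
open SlashInvariantForm Literature.NumberTheory.ModularForms.QExpansionAlgebra Function
open Literature.NumberTheory.Automorphic (qExpansion_coeff_natMul)

/-- Cusp forms of weight `k ≤ 0` on `Γ₁(N)` vanish (Mathlib: negative weight `isZero_of_neg_weight`;
weight `0`: constants, and a cusp form tends to `0` at `i∞`). [folklore] -/
theorem cuspForm_coe_eq_zero_of_weight_le_zero {N : ℕ} [NeZero N] {k : ℤ} (hk : k ≤ 0)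
    (f : CuspForm (Gamma1 N) k) : (⇑f : ℍ → ℂ) = 0 := by
  rcases lt_or_eq_of_le hk with hk | rfl
  · have := ModularForm.isZero_of_neg_weight hk (f : ModularForm (Gamma1 N) k)
    have h : (⇑(f : ModularForm (Gamma1 N) k) : ℍ → ℂ) = 0 := by rw [this]; rfl
    exact h
  · obtain ⟨c, hc⟩ := ModularForm.eq_const_of_weight_zero (f : ModularForm (Gamma1 N) 0)
    have hc' : (⇑f : ℍ → ℂ) = Function.const ℍ c := hc
    have hzero : IsZeroAtImInfty (⇑f : ℍ → ℂ) := by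
      simpa [ModularForm.SL_slash] using CuspFormClass.zero_at_infty_slash f (1 : SL(2, ℤ))
    have hlim : Tendsto (fun _ : ℍ ↦ c) atImInfty (𝓝 0) := by
      have : (fun _ : ℍ ↦ c) = ⇑f := by rw [hc']; rfl
      rw [this]
      exact hzero
    have hc0 : c = 0 := tendsto_nhds_unique tendsto_const_nhds hlim
    rw [hc', hc0]
    rfl

/-- **Sturm's congruence theorem for `Γ₁(N)`, coefficients in `ℤ`, modulo a prime `p`** — the
discharge of the named fact `Sturm1987_congruenceBound_Gamma1_modPrime` (J. Sturm, *On the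
congruence of modular forms*, LNM 1240 (1987), Thm. 1; complete proof in M. Ram Murty,
*Congruences between modular forms*, LMS LNS 247 (1997), Thm. 5, §§3–4). Proof as printed: the
translates `f|γᵢ` over coset representatives of `Γ₁(N)\SL₂(ℤ)` are normalised to be `𝔪`-integral
and `𝔪`-primitive for the maximal ideal `𝔪 ∋ p` of a valuation ring `V ⊆ ℂ`
(`exists_smul_cuspCoeff_mem_and_not_mem_nonunits`, through `S_k(Γ₁(N²))` and Deligne–Serre's
integral structure in place of Shimura's Thm. 3.52 over `ℚ(ζ_N)`); the product of `f` with them is a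
constant multiple of Mathlib's norm `∏ f|γᵢ ∈ M_{kμ}(SL₂(ℤ))`, `μ = [SL₂(ℤ) : Γ₁(N)]`, whose
`𝔪`-order is `≥ ord_𝔪 f > kμ/12` yet finite (`ordP_prod`) — contradicting the level-one case
(`levelOne_qExpansion_coeff_mem`). The hypothesis `p ∤ N` of the named fact is not needed.
[cite: Sturm1987, Thm. 1] [cite: Murty1997Congruences, Thm. 5] -/
theorem Sturm1987_congruenceBound_Gamma1_modPrime_holds :
    Sturm1987_congruenceBound_Gamma1_modPrime := by
  intro N _ p hp _hpN k f z hz hdiv n₀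
  classical
  by_contra hn₀
  have hN : 0 < N := NeZero.pos N
  have hNQ : (0 : ℚ) < N := Nat.cast_pos.mpr hN
  haveI : NeZero (N ^ 2) := ⟨pow_ne_zero 2 (NeZero.ne N)⟩
  -- the least index with `p ∤ zₙ`; it lies above the Sturm bound
  have hex : ∃ n, ¬ (p : ℤ) ∣ z n := ⟨n₀, hn₀⟩
  set m₀ := Nat.find hex with hm₀_def
  have hm₀ : ¬ (p : ℤ) ∣ z m₀ := Nat.find_spec hex
  have hlt : ∀ n < m₀, (p : ℤ) ∣ z n := fun n hn ↦ not_not.mp (Nat.find_min hex hn)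
  have hbound : (k * ((Gamma1 N).index : ℤ)).toNat / 12 < m₀ := by
    by_contra h
    push Not at h
    exact hm₀ (hdiv m₀ h)
  -- `f ≠ 0`, hence `k ≥ 1`
  have hf0 : (⇑f : ℍ → ℂ) ≠ 0 := by
    intro h
    apply hm₀
    have e := hz m₀
    rw [h, qExpansion_zero, map_zero] at e
    have : z m₀ = 0 := by exact_mod_cast e.symm
    rw [this]
    exact dvd_zero _
  have hk : 1 ≤ k := by
    by_contra hk
    push Not at hk
    exact hf0 (cuspForm_coe_eq_zero_of_weight_le_zero (by omega) f)
  -- a valuation ring of `ℂ` above `p`, its maximal ideal `𝔪` as an additive subgroup `P`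
  obtain ⟨V, hpV⟩ := exists_valuationSubring_natCast_mem_nonunits hp
  obtain ⟨P, hP⟩ := exists_addSubgroup_eq_nonunits V
  -- the cosets `Γ₁(N) \ SL₂(ℤ)` (Mathlib: `𝒮ℒ ⧸ Γ₁(N) ∩ 𝒮ℒ`) and representatives
  let _ := Fintype.ofFinite (𝒮ℒ ⧸ (Gamma1 N : Subgroup (GL (Fin 2) ℝ)).subgroupOf 𝒮ℒ)
  choose γ hγ using fun q : (𝒮ℒ ⧸ (Gamma1 N : Subgroup (GL (Fin 2) ℝ)).subgroupOf 𝒮ℒ) ↦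
    exists_coe_rangeRestrict_eq (𝒢 := (Gamma1 N : Subgroup (GL (Fin 2) ℝ))) q
  -- the translates `φ q = f|γ_q⁻¹` and their pushes `ψ q` to level `Γ₁(N²)`
  set φ := fun q ↦ ⇑f ∣[k] (mapGL ℝ (γ q)⁻¹ : GL (Fin 2) ℝ) with hφ
  have hquot : ∀ q, quotientFunc f q = φ q := fun q ↦ by
    have h := quotientFunc_coe_rangeRestrict f (γ q)
    rw [hγ q] at h
    rw [h, hφ, ModularForm.SL_slash]
    rfl
  have hφnice : ∀ q, Periodic (φ q ∘ ofComplex) (N : ℝ) ∧ MDiff (φ q) ∧ IsBoundedAtImInfty (φ q) :=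
    fun q ↦ nice_slash (N := N) (γ q)⁻¹ f
  set ψ : _ → CuspForm (Gamma1 (N ^ 2)) k := fun q ↦
    cuspHeckeCorrespondence (Gamma1 N) (Gamma1 (N ^ 2)) k
      (slToGLPos (γ q)⁻¹ * diagGL (N : ℚ) 1 hNQ one_pos) f with hψ
  have hψcoeff : ∀ q n, cuspCoeff (ψ q) n =
      (N : ℂ) ^ (k - 1) * PowerSeries.coeff n (qExpansion (N : ℝ) (φ q)) := fun q n ↦
    cuspCoeff_cuspHeckeCorrespondence_slToGLPos_mul_diagGL hNQ (γ q)⁻¹ f n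
  have hψ0 : ∀ q, ψ q ≠ 0 := by
    intro q hq
    apply hf0
    have h1 := coe_cuspHeckeCorrespondence_slToGLPos_mul_diagGL hNQ (γ q)⁻¹ f
    have h2 : (⇑(ψ q) : ℍ → ℂ) = 0 := by rw [hq]; rfl
    rw [hψ] at h2
    dsimp only at h2
    rw [h2, ← SlashAction.slash_mul] at h1
    have h3 := congrArg (fun F : ℍ → ℂ ↦ F ∣[k] ((mapGL ℝ (γ q)⁻¹ : GL (Fin 2) ℝ) *
      glCast (diagGL (N : ℚ) 1 hNQ one_pos))⁻¹) h1
    simpa only [SlashAction.zero_slash, ← SlashAction.slash_mul, mul_inv_cancel,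
      SlashAction.slash_one] using h3.symm
  -- `𝔪`-primitive normalisations `s q` of the `ψ q`
  choose s hsV hsn using fun q ↦
    exists_smul_cuspCoeff_mem_and_not_mem_nonunits V hp hpV hk (ψ q) (hψ0 q)
  -- the power series `A q = s_q N^{k-1} · qExpansion_N (φ q) = s_q · qExpansion_1 (ψ q)`
  set t := fun q ↦ s q * (N : ℂ) ^ (k - 1) with ht
  set A := fun q ↦ PowerSeries.C (t q) * qExpansion (N : ℝ) (φ q) with hA_def
  have hA : ∀ q n, PowerSeries.coeff n (A q) = s q * cuspCoeff (ψ q) n := fun q n ↦ by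
    simp only [hA_def, ht, PowerSeries.coeff_C_mul, hψcoeff]
    ring
  have hAint : ∀ q n, PowerSeries.coeff n (A q) ∈ V := fun q n ↦ by rw [hA]; exact hsV q n
  have hAord : ∀ q, ∃ a, (∀ j < a, PowerSeries.coeff j (A q) ∈ V.nonunits) ∧
      PowerSeries.coeff a (A q) ∉ V.nonunits := fun q ↦ by
    obtain ⟨n, hn⟩ := hsn q
    exact exists_ordP ⟨n, by rw [hA]; exact hn⟩
  choose a ha using hAord
  -- the expansion `F` of `f` at the period `N` and its `𝔪`-order `N m₀`
  set F : PowerSeries ℂ := qExpansion (N : ℝ) ⇑f with hF_def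
  have hFcoeff : ∀ j, PowerSeries.coeff j F = if N ∣ j then (z (j / N) : ℂ) else 0 := fun j ↦ by
    have h := qExpansion_coeff_natMul (f : ModularForm (Gamma1 N) k) one_pos
      (HeckeTGamma1.one_mem_strictPeriods_Gamma1 N) (NeZero.ne N) j
    rw [mul_one] at h
    rw [hF_def, show (⇑f : ℍ → ℂ) = ⇑(f : ModularForm (Gamma1 N) k) from rfl, h]
    split_ifs with hdvd
    · exact hz (j / N)
    · rfl
  have hFint : ∀ j, PowerSeries.coeff j F ∈ V := fun j ↦ by
    rw [hFcoeff]
    split_ifs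
    · exact intCast_mem V _
    · exact zero_mem V
  have hFord : (∀ j < N * m₀, PowerSeries.coeff j F ∈ V.nonunits) ∧
      PowerSeries.coeff (N * m₀) F ∉ V.nonunits := by
    constructor
    · intro j hj
      rw [hFcoeff]
      split_ifs with hdvd
      · rw [intCast_mem_nonunits_iff hp hpV]
        refine hlt _ ?_
        obtain ⟨i, rfl⟩ := hdvd
        rw [Nat.mul_div_cancel_left i hN]
        exact Nat.lt_of_mul_lt_mul_left hj
      · exact zero_mem_nonunits
    · rw [hFcoeff, if_pos (dvd_mul_right N m₀), Nat.mul_div_cancel_left m₀ hN,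
        intCast_mem_nonunits_iff hp hpV]
      exact hm₀
  -- the identity coset `q₁` and `Ψ = F · ∏_{q ≠ q₁} A q`
  set q₁ := (((mapGL ℝ).rangeRestrict 1 : 𝒮ℒ) :
    (𝒮ℒ ⧸ (Gamma1 N : Subgroup (GL (Fin 2) ℝ)).subgroupOf 𝒮ℒ)) with hq₁
  have hφ₁ : φ q₁ = ⇑f := by
    rw [← hquot q₁, hq₁, quotientFunc_coe_rangeRestrict, inv_one, SlashAction.slash_one]
  set S := Finset.univ.erase q₁ with hS
  set Ψ : PowerSeries ℂ := F * ∏ q ∈ S, A q with hΨ_def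
  obtain ⟨hPint, hPord1, hPord2⟩ := ordP_prod S A a (fun q _ ↦ hAint q) (fun q _ ↦ ha q)
  obtain ⟨-, hΨord1', hΨord2'⟩ := ordP_mul hFint hPint hFord ⟨hPord1, hPord2⟩
  have hΨord1 : ∀ i < N * m₀ + ∑ q ∈ S, a q, PowerSeries.coeff i Ψ ∈ V.nonunits := hΨord1'
  have hΨord2 : PowerSeries.coeff (N * m₀ + ∑ q ∈ S, a q) Ψ ∉ V.nonunits := hΨord2'
  -- `Ψ` is the period-`N` expansion of the level-one form `G = c · Norm(f)`
  set c : ℂ := ∏ q ∈ S, t q with hc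
  set G := c • ModularForm.norm 𝒮ℒ f with hG
  have hnorm : (⇑(ModularForm.norm 𝒮ℒ f) : ℍ → ℂ) = ∏ q, φ q := by
    funext τ
    simp only [ModularForm.coe_norm, Finset.prod_apply, hquot]
  have hnormnice := nice_prod Finset.univ (H := (N : ℝ)) (F := φ) (fun q _ ↦ hφnice q)
  have hGcoe : (⇑G : ℍ → ℂ) = c • ∏ q, φ q := by rw [hG, IsGLPos.coe_smul, hnorm]
  have hΨG : Ψ = qExpansion (N : ℝ) ⇑G := by
    rw [hGcoe, qExpansion_smul_of_nice (Nat.cast_pos.mpr hN) c hnormnice,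
      qExpansion_prod_of_nice _ (Nat.cast_pos.mpr hN) (fun q _ ↦ hφnice q),
      ← Finset.mul_prod_erase _ _ (Finset.mem_univ q₁), hφ₁, ← hF_def, ← hS, hΨ_def,
      PowerSeries.smul_eq_C_mul, hc]
    simp only [hA_def]
    rw [Finset.prod_mul_distrib, map_prod]
    ring
  have hGcoeff : ∀ j, PowerSeries.coeff j (qExpansion (N : ℝ) ⇑G) =
      if N ∣ j then PowerSeries.coeff (j / N) (qExpansion 1 ⇑G) else 0 := fun j ↦ by
    have h := qExpansion_coeff_natMul G one_pos one_mem_strictPeriods_SL (NeZero.ne N) j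
    rwa [mul_one] at h
  -- level one: the coefficients of `G` up to the Sturm bound lie in `𝔪`, hence all of them do
  have hcard := card_quotient_subgroupOf_eq_index (Gamma1 N)
  have hsmall : ∀ n ≤ (k * (Nat.card
      (𝒮ℒ ⧸ (Gamma1 N : Subgroup (GL (Fin 2) ℝ)).subgroupOf 𝒮ℒ) : ℤ)).toNat / 12,
      PowerSeries.coeff n (qExpansion 1 ⇑G) ∈ P := by
    intro n hn
    rw [hcard] at hn
    have hnm : n < m₀ := lt_of_le_of_lt hn hbound
    have h1 : PowerSeries.coeff (N * n) Ψ ∈ V.nonunits :=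
      hΨord1 _ (lt_of_lt_of_le ((Nat.mul_lt_mul_left hN).mpr hnm) (Nat.le_add_right _ _))
    rw [hΨG, hGcoeff, if_pos (dvd_mul_right N n), Nat.mul_div_cancel_left n hN] at h1
    exact (hP _).mpr h1
  have hall := levelOne_qExpansion_coeff_mem P G hsmall
  -- so every coefficient of `Ψ` lies in `𝔪`: contradiction with its finite `𝔪`-order
  apply hΨord2
  rw [hΨG, hGcoeff]
  split_ifs with hdvd
  · exact (hP _).mp (hall _)
  · exact zero_mem_nonunits

end Main

end Literature.NumberTheory.ModularForms
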